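import Mathlib
import Summits.Ventures.PercRepro2.Defs
import Summits.Ventures.PercRepro2.Harris
import Summits.Ventures.PercRepro2.Graph
import Summits.Ventures.PercRepro2.Induced
import Summits.Ventures.PercRepro2.VdBKahn
import Summits.Ventures.PercRepro2.NestIID
import Summits.Ventures.PercRepro2.SideDefs
import Summits.Ventures.PercRepro2.SideLogSupermod
import Summits.Ventures.PercRepro2.WForm
import Summits.Ventures.PercRepro2.WStatus

/-!
# The typed-base (tensor-Bernstein) expansion of the W-inequality (blind cell PercRepro2, mine-1 g14)
proofs/MINE1-WBERN.md §3; MINE-1.md §30.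

The two-copy weight `weight p ω₁ · weight p ω₂` depends on the pair only through the EDGE-COUNT
vector `n = ω₁ + ω₂ ∈ {0,1,2}^E` (the cell's typed bases: type 0 = closed in both copies, 1 = open in
exactly one, 2 = open in both): it equals `typedWeight p n = ∏ₑ pₑ^{nₑ} (1 − pₑ)^{2 − nₑ}`. Hence the
W-form of the status law is a nonnegative combination of the WEIGHT-FREE typed-base coefficients
`typedCoef g h n = Σ_{ω₁ + ω₂ = n} Φ_{g,h}(ω₁, ω₂)`, where `Φ` is the pair kernel of the status law
(the summand of `WForm.Q` with the two status masses expanded into configurations). This file proves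
the expansion (`Q_eq_sum_typedWeight_mul_typedCoef`) and the reduction
`wIneqStatus_of_typedCoef_nonneg`: if every typed-base coefficient of every monotone pair is
nonnegative, the W-inequality holds; `wRow_of_wBernRow` states it for the conjecture of record.
`WBernRow` (every typed-base coefficient ≥ 0, i.e. the W-inequality in the complementary model of
every contraction/deletion) is census-true at n ≤ 6 (4.5·10¹⁰ integer coefficients, 0 negative) and
is a `Prop`, not a theorem.
-/

namespace Summit.Ventures.PercRepro2

section Expand

variable {V : Type*} {E : Type*} [Fintype E] [DecidableEq E] [Fintype V] [DecidableEq V]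
  {R : Type*} [CommRing R]

/-- The edge-count (type) vector of a pair of configurations: `0`, `1` or `2` open copies of each edge. -/
def typeVec (ω₁ ω₂ : Config E) : E → ℕ := fun e => (ω₁ e).toNat + (ω₂ e).toNat

/-- The typed-base weight `∏ₑ pₑ^{nₑ} (1 − pₑ)^{2 − nₑ}`. -/
def typedWeight (p : E → R) (n : E → ℕ) : R := ∏ e, (p e) ^ (n e) * (1 - p e) ^ (2 - n e)

omit [Fintype E] [DecidableEq E] [Fintype V] [DecidableEq V] in
/-- One edge: the product of the two Bernoulli factors is the typed factor of the edge count. -/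
lemma edgeFactor_mul_edgeFactor (q : R) (b₁ b₂ : Bool) :
    edgeFactor q b₁ * edgeFactor q b₂ =
      q ^ (b₁.toNat + b₂.toNat) * (1 - q) ^ (2 - (b₁.toNat + b₂.toNat)) := by
  cases b₁ <;> cases b₂ <;> simp [edgeFactor] <;> ring

omit [DecidableEq E] [Fintype V] [DecidableEq V] in
/-- The two-copy weight depends on the pair only through its type vector. -/
lemma weight_mul_weight_eq_typedWeight (p : E → R) (ω₁ ω₂ : Config E) :
    weight p ω₁ * weight p ω₂ = typedWeight p (typeVec ω₁ ω₂) := by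
  unfold weight typedWeight typeVec
  rw [← Finset.prod_mul_distrib]
  exact Finset.prod_congr rfl fun e _ => edgeFactor_mul_edgeFactor (p e) (ω₁ e) (ω₂ e)

variable (p : E → R) (ends : E → Sym2 V) (s : V) (T F : Finset V)

/-- The status event of `S` (empty unless `S ⊆ F`): `C ∩ F = S` and `C ∩ T = ∅`. -/
def statusEvent (S : Finset V) : Set (Config E) :=
  if S ⊆ F then connAll ends s S ∩ avoidAll ends s (T ∪ (F \ S)) else ∅

omit [Fintype V] in
/-- The status mass is the sum of the weights of the configurations in the status event. -/
lemma statusW_eq_sum (S : Finset V) :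
    statusW p ends s T F S = ∑ ω, (statusEvent ends s T F S).indicator (weight p) ω := by
  unfold statusW statusEvent
  split_ifs with h
  · rfl
  · simp

/-- The pair kernel of the status law: the summand of the W-form with both status masses expanded
into configurations (`g, h : Finset V → R`). -/
noncomputable def pairKernel (g h : Finset V → R) (ω₁ ω₂ : Config E) : R :=
  ∑ S : Finset V, ∑ S' : Finset V,
    (if Disjoint S S' then
      (statusEvent ends s T F S).indicator (fun _ => (1 : R)) ω₁ *
        (statusEvent ends s T F S').indicator (fun _ => (1 : R)) ω₂ else 0) *
      ((g S - g S') * (h S - h S'))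

/-- The typed-base coefficient of the pair `(g, h)` at the type vector `n`: the sum of the pair kernel
over the pairs of configurations with edge counts `n` (weight-free). -/
noncomputable def typedCoef (g h : Finset V → R) (n : E → ℕ) : R :=
  ∑ x ∈ (Finset.univ : Finset (Config E × Config E)).filter (fun x => typeVec x.1 x.2 = n),
    pairKernel ends s T F g h x.1 x.2

omit [DecidableEq E] [Fintype V] [DecidableEq V] in
/-- Expanding one status mass in a product with an indicator. -/
lemma indicator_weight_eq (A : Set (Config E)) (ω : Config E) :
    A.indicator (weight p) ω = weight p ω * A.indicator (fun _ => (1 : R)) ω := by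
  by_cases h : ω ∈ A
  · simp [Set.indicator_of_mem h]
  · simp [Set.indicator_of_notMem h]

omit [Fintype E] [DecidableEq E] [Fintype V] [DecidableEq V] in
/-- Four nested sums: the outer pair and the inner pair commute. -/
lemma sum_four_comm {α β γ δ : Type*} [Fintype α] [Fintype β] [Fintype γ] [Fintype δ]
    (f : α → β → γ → δ → R) :
    ∑ a, ∑ b, ∑ c, ∑ d, f a b c d = ∑ c, ∑ d, ∑ a, ∑ b, f a b c d := by
  calc ∑ a, ∑ b, ∑ c, ∑ d, f a b c d
      = ∑ a, ∑ c, ∑ b, ∑ d, f a b c d := Finset.sum_congr rfl fun a _ => Finset.sum_comm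
    _ = ∑ a, ∑ c, ∑ d, ∑ b, f a b c d :=
        Finset.sum_congr rfl fun a _ => Finset.sum_congr rfl fun c _ => Finset.sum_comm
    _ = ∑ c, ∑ a, ∑ d, ∑ b, f a b c d := Finset.sum_comm
    _ = ∑ c, ∑ d, ∑ a, ∑ b, f a b c d := Finset.sum_congr rfl fun c _ => Finset.sum_comm

/-- **The expansion**: the W-form of the status law is the double sum over pairs of configurations
of the two-copy weight times the pair kernel. -/
theorem Q_eq_sum_pairs (g h : Finset V → R) :
    WForm.Q (fun S S' : Finset V => Disjoint S S') (statusW p ends s T F) g h =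
      ∑ ω₁ : Config E, ∑ ω₂ : Config E,
        weight p ω₁ * weight p ω₂ * pairKernel ends s T F g h ω₁ ω₂ := by
  unfold WForm.Q WForm.S WForm.coef
  simp_rw [statusW_eq_sum]
  have key : ∀ (S S' : Finset V),
      (if Disjoint S S' then
          (∑ ω, (statusEvent ends s T F S).indicator (weight p) ω) *
            ∑ ω, (statusEvent ends s T F S').indicator (weight p) ω
        else 0) * ((g S - g S') * (h S - h S')) =
      ∑ ω₁ : Config E, ∑ ω₂ : Config E, weight p ω₁ * weight p ω₂ *
        ((if Disjoint S S' then
          (statusEvent ends s T F S).indicator (fun _ => (1 : R)) ω₁ *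
            (statusEvent ends s T F S').indicator (fun _ => (1 : R)) ω₂ else 0) *
          ((g S - g S') * (h S - h S'))) := by
    intro S S'
    by_cases hD : Disjoint S S'
    · simp only [if_pos hD]
      rw [Finset.sum_mul_sum]
      simp_rw [Finset.sum_mul]
      refine Finset.sum_congr rfl fun ω₁ _ => Finset.sum_congr rfl fun ω₂ _ => ?_
      rw [indicator_weight_eq, indicator_weight_eq]
      ring
    · simp [if_neg hD]
  simp_rw [key]
  unfold pairKernel
  simp_rw [Finset.mul_sum]
  exact sum_four_comm _

/-- **The typed-base expansion**: the W-form is the sum over type vectors of the typed weight times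
the typed-base coefficient. -/
theorem Q_eq_sum_typedWeight_mul_typedCoef (g h : Finset V → R) :
    WForm.Q (fun S S' : Finset V => Disjoint S S') (statusW p ends s T F) g h =
      ∑ n ∈ (Finset.univ : Finset (Config E × Config E)).image (fun x => typeVec x.1 x.2),
        typedWeight p n * typedCoef ends s T F g h n := by
  rw [Q_eq_sum_pairs]
  have h2 : ∑ ω₁ : Config E, ∑ ω₂ : Config E,
      weight p ω₁ * weight p ω₂ * pairKernel ends s T F g h ω₁ ω₂ =
      ∑ x : Config E × Config E,
        weight p x.1 * weight p x.2 * pairKernel ends s T F g h x.1 x.2 := by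
    rw [← Finset.univ_product_univ, Finset.sum_product]
  rw [h2]
  unfold typedCoef
  rw [← Finset.sum_fiberwise_of_maps_to (g := fun x : Config E × Config E => typeVec x.1 x.2)
      (t := (Finset.univ : Finset (Config E × Config E)).image (fun x => typeVec x.1 x.2))
      (fun x hx => Finset.mem_image_of_mem _ hx)]
  refine Finset.sum_congr rfl fun n _ => ?_
  rw [Finset.mul_sum]
  refine Finset.sum_congr rfl fun x hx => ?_
  have hn : typeVec x.1 x.2 = n := (Finset.mem_filter.mp hx).2
  rw [weight_mul_weight_eq_typedWeight, hn]

end Expand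

section Reduction

variable {V : Type*} {E : Type*} [Fintype E] [DecidableEq E] [Fintype V] [DecidableEq V]
  {R : Type*} [CommRing R] [LinearOrder R] [IsStrictOrderedRing R]

omit [DecidableEq E] [Fintype V] [DecidableEq V] in
/-- Typed-base weights are nonnegative for admissible weight vectors. -/
lemma typedWeight_nonneg {p : E → R} (hp : IsProbVec p) (n : E → ℕ) : 0 ≤ typedWeight p n := by
  unfold typedWeight
  refine Finset.prod_nonneg fun e _ => mul_nonneg (pow_nonneg (hp.nonneg e) _) (pow_nonneg ?_ _)
  exact sub_nonneg.mpr (hp.le_one e)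

/-- **Reduction**: if every typed-base coefficient of every monotone pair is nonnegative, the
W-inequality holds for the status law. -/
theorem wIneqStatus_of_typedCoef_nonneg (ends : E → Sym2 V) (s : V) (T F : Finset V)
    {p : E → R} (hp : IsProbVec p)
    (hc : ∀ g h : Finset V → R, Monotone g → Monotone h → ∀ n : E → ℕ,
      0 ≤ typedCoef ends s T F g h n) :
    WIneqStatus p ends s T F := by
  refine ⟨statusW_nonneg ends s T F hp, ?_⟩
  intro g h hg hh
  rw [Q_eq_sum_typedWeight_mul_typedCoef]
  exact Finset.sum_nonneg fun n _ => mul_nonneg (typedWeight_nonneg hp n) (hc g h hg hh n)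

end Reduction

/-- **The typed-base conjecture of record**: every typed-base coefficient of the W-form of every
status law is nonnegative, for every monotone pair — the W-inequality in the complementary model
of every contraction/deletion of every finite graph (census-true at n ≤ 6; a `Prop`). -/
def WBernRow : Prop :=
  ∀ {V : Type} {E : Type} [Fintype E] [DecidableEq E] [Fintype V] [DecidableEq V]
    (ends : E → Sym2 V) (s : V) (T F : Finset V), Disjoint T F → s ∉ F →
    ∀ g h : Finset V → ℚ, Monotone g → Monotone h → ∀ n : E → ℕ,
      0 ≤ typedCoef ends s T F g h n

/-- The W-inequality of record follows from its typed-base form. -/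
theorem wRow_of_wBernRow (h : WBernRow) : WRow := by
  intro V E _ _ _ _ p hp ends s T F hTF hsF
  exact wIneqStatus_of_typedCoef_nonneg ends s T F hp (h ends s T F hTF hsF)

end Summit.Ventures.PercRepro2
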